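import Mathlib
import HarnessLib

/-!
# Determinantal identities for the compression of `diag(x)` to `𝟙^⊥` (Saunderson–Parrilo, Lemmas 1, 3, 4)

Topic `Literature/AlgebraicGeometry/HyperbolicPolynomials`. Let `V` be an `(n+1) × n` real matrix
with orthonormal columns spanning `𝟙^⊥` (`Vᵀ V = I`, `Vᵀ 𝟙 = 0`, `V Vᵀ = I - 𝟙𝟙ᵀ/(n+1)`; such a
`V` exists, `exists_compressionMatrix`, from a Householder reflection). Saunderson–Parrilo
(Math. Program. 153 (2015), arXiv:1208.1443) prove

* Lemma 1 (§3.1, eq. (15)): `e_n(x + t𝟙) = (n+1) det(Vᵀ diag(x) V + t I)` for `x ∈ ℝ^{n+1}`, whence,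
  comparing coefficients (proof of Prop. 2), `(n+1) E_j(Vᵀ diag(x) V) = (n+1-j) e_j(x)`;
* Lemmas 3–4 (§3.2, eq. (18) and Lemma 4): for `e₁(x) ≠ 0` and the Schur complement
  `S(x) = Vᵀ diag(x) V - (Vᵀx)(Vᵀx)ᵀ / e₁(x)`, `e₁(x) E_j(S(x)) = (j+1) e_{j+1}(x)`.

Here `E_j(Y) = e_j(λ(Y))` for a symmetric `Y`; we phrase both through an arbitrary orthogonal
diagonalisation `Y = U diag(d) Uᵀ` (`esymm_eigenvalues_compression`,
`esymm_eigenvalues_schurCompression`). DEVIATION from the printed proofs: instead of the symmetry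
characterisation of `e_n` (Lemma 1) and the inversion `x ↦ x⁻¹` (Lemma 3) we use the
Weinstein–Aronszajn identity `det(I + AB) = det(I + BA)` and the rank-one matrix determinant lemma
for `diag(t + xᵢ)`, valid for all but finitely many `t`, and then compare polynomial coefficients.

## References

* [SaundersonParrilo2014] J. Saunderson, P. A. Parrilo, Math. Program. 153 (2015) 309–331
  (arXiv:1208.1443): §2 (the identity `e_{n-1}(x) = n det(V_nᵀ diag(x) V_n)`), Lemma 1, proof of
  Prop. 2 (coefficient comparison), Lemma 3, Lemma 4.
-/

noncomputable section

open Matrix Polynomial Finset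
open scoped BigOperators

namespace Literature.AlgebraicGeometry.HyperbolicPolynomials

/-! ### An orthogonal matrix whose last column is `𝟙/√(n+1)` (Householder reflection) -/

/-- There is an orthogonal `(n+1) × (n+1)` matrix whose last column is the unit vector
`𝟙/√(n+1)` (the Householder reflection exchanging `e_{n+1}` and `𝟙/√(n+1)`). [folklore] -/
theorem exists_orthogonal_lastCol_const (n : ℕ) :
    ∃ Q : Matrix (Fin (n + 1)) (Fin (n + 1)) ℝ,
      Qᵀ * Q = 1 ∧ ∀ i, Q i (Fin.last n) = (Real.sqrt ((n : ℝ) + 1))⁻¹ := by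
  set c : ℝ := (Real.sqrt ((n : ℝ) + 1))⁻¹ with hc
  have hN : (0 : ℝ) < (n : ℝ) + 1 := by positivity
  have hsq : Real.sqrt ((n : ℝ) + 1) ^ 2 = (n : ℝ) + 1 := Real.sq_sqrt hN.le
  have hsqpos : 0 < Real.sqrt ((n : ℝ) + 1) := Real.sqrt_pos.2 hN
  set b : Fin (n + 1) → ℝ := fun _ => c with hb
  set a : Fin (n + 1) → ℝ := Pi.single (Fin.last n) 1 with ha
  have hbb : b ⬝ᵥ b = 1 := by
    simp only [hb, dotProduct, Finset.sum_const, Finset.card_univ, Fintype.card_fin, nsmul_eq_mul,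
      hc]
    field_simp
    push_cast
    rw [hsq]
  have haa : a ⬝ᵥ a = 1 := by simp [ha]
  have hab : a ⬝ᵥ b = c := by simp [ha, hb]
  have hba : b ⬝ᵥ a = c := by rw [dotProduct_comm, hab]
  set w : Fin (n + 1) → ℝ := a - b with hw
  have hww : w ⬝ᵥ w = 2 - 2 * c := by
    simp only [hw, sub_dotProduct, dotProduct_sub, haa, hab, hba, hbb]
    ring
  have hwa : w ⬝ᵥ a = 1 - c := by
    simp only [hw, sub_dotProduct, haa, hba]
  by_cases h0 : w ⬝ᵥ w = 0
  · -- then `a = b` and `Q = 1` works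
    have hw0 : w = 0 := dotProduct_self_eq_zero.1 h0
    have hab' : a = b := sub_eq_zero.1 (by rw [← hw]; exact hw0)
    refine ⟨1, by simp, fun i => ?_⟩
    have := congrFun hab' i
    simp only [ha, hb] at this
    rw [Matrix.one_apply, ← this, Pi.single_apply]
  · set r : ℝ := 2 / (w ⬝ᵥ w) with hr
    refine ⟨1 - r • vecMulVec w w, ?_, fun i => ?_⟩
    · have hsymm : (1 - r • vecMulVec w w)ᵀ = 1 - r • vecMulVec w w := by
        rw [transpose_sub, transpose_one, transpose_smul, transpose_vecMulVec]
      have hrr : r * r * (w ⬝ᵥ w) = 2 * r := by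
        rw [hr]
        field_simp
      have key : (r • vecMulVec w w) * (r • vecMulVec w w) = (2 * r) • vecMulVec w w := by
        rw [Matrix.smul_mul, Matrix.mul_smul, vecMulVec_mul_vecMulVec, vecMulVec_smul, smul_smul,
          smul_smul, hrr]
      rw [hsymm, sub_mul, one_mul, mul_sub, mul_one, key]
      module
    · -- the last column: `Q e_last = a - r (w ⬝ a) w = a - w = b`
      have hcol : (1 - r • vecMulVec w w) *ᵥ a = b := by
        have hv : vecMulVec w w *ᵥ a = (w ⬝ᵥ a) • w := by
          funext i
          simp only [mulVec, dotProduct, vecMulVec_apply, Pi.smul_apply, smul_eq_mul]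
          rw [Finset.sum_mul]
          exact Finset.sum_congr rfl fun j _ => by ring
        rw [sub_mulVec, one_mulVec, smul_mulVec, hv, smul_smul]
        have hra : r * (w ⬝ᵥ a) = 1 := by
          have h2c : (2 : ℝ) - 2 * c ≠ 0 := by rwa [hww] at h0
          have h1c : (1 : ℝ) - c ≠ 0 := fun h => h2c (by linarith)
          rw [hr, hwa, hww, div_mul_eq_mul_div, div_eq_one_iff_eq h2c]
          ring
        rw [hra, one_smul, hw, sub_sub_cancel]
      have := congrFun hcol i
      rw [ha, mulVec_single_one] at this
      simpa [hb] using this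

/-- **The compression matrix `V_n`.** There is an `(n+1) × n` real matrix with orthonormal columns
spanning the orthogonal complement of `𝟙`: `Vᵀ V = I_n`, `Vᵀ 𝟙 = 0` and
`V Vᵀ = I_{n+1} - 𝟙𝟙ᵀ/(n+1)` (Saunderson–Parrilo §2: "an `n × (n-1)` matrix with orthonormal
columns that are each orthogonal to `𝟙_n`"). [cite: SaundersonParrilo2014, §2 (definition of V_n)] -/
theorem exists_compressionMatrix (n : ℕ) :
    ∃ V : Matrix (Fin (n + 1)) (Fin n) ℝ, Vᵀ * V = 1 ∧ Vᵀ *ᵥ (fun _ => (1 : ℝ)) = 0 ∧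
      V * Vᵀ = 1 - ((n : ℝ) + 1)⁻¹ • Matrix.of (fun _ _ => (1 : ℝ)) := by
  obtain ⟨Q, hQ, hlast⟩ := exists_orthogonal_lastCol_const n
  set c : ℝ := (Real.sqrt ((n : ℝ) + 1))⁻¹ with hc
  have hN : (0 : ℝ) < (n : ℝ) + 1 := by positivity
  have hcpos : 0 < c := inv_pos.2 (Real.sqrt_pos.2 hN)
  have hcc : c * c = ((n : ℝ) + 1)⁻¹ := by
    rw [hc, ← mul_inv, Real.mul_self_sqrt hN.le]
  have hQ' : Q * Qᵀ = 1 := mul_eq_one_comm.1 hQ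
  refine ⟨Matrix.of fun i j => Q i (Fin.castSucc j), ?_, ?_, ?_⟩
  · ext j k
    have h := congrFun (congrFun hQ (Fin.castSucc j)) (Fin.castSucc k)
    simp only [mul_apply, transpose_apply, of_apply] at h ⊢
    rw [h]
    simp only [Matrix.one_apply, Fin.castSucc_inj]
  · funext j
    have h := congrFun (congrFun hQ (Fin.castSucc j)) (Fin.last n)
    simp only [mul_apply, transpose_apply, hlast, Matrix.one_apply,
      (Fin.castSucc_lt_last j).ne, if_false, ← Finset.sum_mul] at h
    have hsum : ∑ i, Q i (Fin.castSucc j) = 0 := by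
      rcases mul_eq_zero.1 h with h | h
      · exact h
      · exact absurd h hcpos.ne'
    simp only [mulVec, dotProduct, transpose_apply, of_apply, mul_one, Pi.zero_apply]
    exact hsum
  · ext i l
    have h := congrFun (congrFun hQ' i) l
    simp only [mul_apply, transpose_apply] at h
    rw [Fin.sum_univ_castSucc, hlast, hlast, hcc] at h
    simp only [mul_apply, transpose_apply, of_apply, Matrix.sub_apply, Matrix.smul_apply, smul_eq_mul,
      mul_one]
    rw [← h]
    ring

/-! ### The rank-one matrix determinant lemma for an invertible diagonal matrix -/

/-- `det(diag(w) + u vᵀ) = (∏ wᵢ)(1 + ∑ vᵢ uᵢ / wᵢ)` for nonvanishing `w` (matrix determinant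
lemma). [folklore] -/
theorem det_diagonal_add_vecMulVec {ι : Type*} [Fintype ι] [DecidableEq ι] (w u v : ι → ℝ)
    (hw : ∀ i, w i ≠ 0) :
    det (diagonal w + vecMulVec u v) = (∏ i, w i) * (1 + ∑ i, v i * (u i / w i)) := by
  have hfac : diagonal w + vecMulVec u v =
      diagonal w * (1 + replicateCol Unit (fun i => u i / w i) * replicateRow Unit v) := by
    rw [Matrix.mul_add, Matrix.mul_one, ← Matrix.mul_assoc, vecMulVec_eq Unit]
    congr 2
    ext i k
    simp only [mul_apply, diagonal_apply, replicateCol_apply, ite_mul, zero_mul,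
      Finset.sum_ite_eq, Finset.mem_univ, if_true]
    have hwi := hw i
    field_simp
  rw [hfac, det_mul, det_diagonal, det_one_add_replicateCol_mul_replicateRow]
  rfl

/-! ### The generating polynomial `p_x(X) = ∏ (X + xᵢ)` -/

section GenPoly

variable {N : ℕ}

/-- Coefficients of `∏ᵢ (X + xᵢ)`: the coefficient of `X^m` is `e_{N-m}(x)` (Vieta). [folklore] -/
theorem coeff_prod_X_add_C_eq_esymm (x : Fin N → ℝ) {m : ℕ} (hm : m ≤ N) :
    (∏ i, (X + C (x i))).coeff m = MvPolynomial.eval x (MvPolynomial.esymm (Fin N) ℝ (N - m)) := by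
  rw [Finset.prod_X_add_C_coeff _ _ (by simpa using hm), Finset.card_univ, Fintype.card_fin]
  simp [MvPolynomial.esymm, map_sum, map_prod]

/-- `∑ᵢ xᵢ ∏_{j ≠ i} (X + xⱼ) = N·p - X·p'` for `p = ∏ᵢ (X + xᵢ)`. [folklore] -/
theorem sum_C_mul_prod_erase_eq (x : Fin N → ℝ) :
    ∑ i, C (x i) * ∏ j ∈ univ.erase i, (X + C (x j)) =
      (N : ℝ[X]) * ∏ i, (X + C (x i)) - X * derivative (∏ i, (X + C (x i))) := by
  rw [derivative_prod_finset]
  simp only [derivative_add, derivative_X, derivative_C, add_zero, mul_one]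
  rw [Finset.mul_sum]
  have h : ∀ i ∈ (univ : Finset (Fin N)), C (x i) * ∏ j ∈ univ.erase i, (X + C (x j)) =
      ∏ j, (X + C (x j)) - X * ∏ j ∈ univ.erase i, (X + C (x j)) := by
    intro i hi
    rw [← Finset.mul_prod_erase _ _ hi]
    ring
  rw [Finset.sum_congr rfl h, Finset.sum_sub_distrib, Finset.sum_const, Finset.card_univ,
    Fintype.card_fin, nsmul_eq_mul]

/-- Coefficient of `X^m` in `∑ᵢ xᵢ ∏_{j ≠ i} (X + xⱼ)`: `(N - m) e_{N-m}(x)`. [folklore] -/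
theorem coeff_sum_C_mul_prod_erase (x : Fin N → ℝ) {m : ℕ} (hm : m ≤ N) :
    (∑ i, C (x i) * ∏ j ∈ univ.erase i, (X + C (x j))).coeff m =
      ((N : ℝ) - m) * MvPolynomial.eval x (MvPolynomial.esymm (Fin N) ℝ (N - m)) := by
  rw [sum_C_mul_prod_erase_eq, coeff_sub, ← C_eq_natCast, coeff_C_mul,
    coeff_prod_X_add_C_eq_esymm x hm]
  rcases Nat.eq_zero_or_pos m with rfl | hm0
  · rw [mul_comm X, coeff_mul_X_zero]
    simp
  · obtain ⟨m', rfl⟩ := Nat.exists_eq_add_of_le' hm0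
    rw [coeff_X_mul, coeff_derivative, coeff_prod_X_add_C_eq_esymm x hm]
    push_cast
    ring

/-- Coefficient of `X^m` in `p' = ∑ᵢ ∏_{j ≠ i} (X + xⱼ)`: `(m+1) e_{N-(m+1)}(x)`. [folklore] -/
theorem coeff_derivative_prod_X_add_C (x : Fin N → ℝ) {m : ℕ} (hm : m + 1 ≤ N) :
    (derivative (∏ i, (X + C (x i)))).coeff m =
      ((m : ℝ) + 1) * MvPolynomial.eval x (MvPolynomial.esymm (Fin N) ℝ (N - (m + 1))) := by
  rw [coeff_derivative, coeff_prod_X_add_C_eq_esymm x hm]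
  ring

/-- `p' = ∑ᵢ ∏_{j ≠ i} (X + xⱼ)`. [folklore] -/
theorem derivative_prod_X_add_C_eq (x : Fin N → ℝ) :
    derivative (∏ i, (X + C (x i))) = ∑ i, ∏ j ∈ univ.erase i, (X + C (x j)) := by
  rw [derivative_prod_finset]
  simp only [derivative_add, derivative_X, derivative_C, add_zero, mul_one]

/-- For all `t` outside a finite set, `t ≠ 0` and `t + xᵢ ≠ 0` for all `i`. [folklore] -/
theorem infinite_setOf_generic (x : Fin N → ℝ) :
    {t : ℝ | t ≠ 0 ∧ ∀ i, t + x i ≠ 0}.Infinite := by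
  have hfin : ({0} ∪ Set.range fun i => -x i : Set ℝ).Finite :=
    (Set.finite_singleton 0).union (Set.finite_range _)
  refine (hfin.infinite_compl).mono fun t ht => ?_
  simp only [Set.mem_compl_iff, Set.mem_union, Set.mem_singleton_iff, Set.mem_range, not_or,
    not_exists] at ht
  refine ⟨ht.1, fun i h => ht.2 i ?_⟩
  linarith

end GenPoly

/-! ### The two determinantal identities, pointwise in `t` -/

section Pointwise

variable {n : ℕ} {V : Matrix (Fin (n + 1)) (Fin n) ℝ}

/-- `t • I + Vᵀ B V = t • (I + Vᵀ (t⁻¹ B) V)` and the Weinstein–Aronszajn swap: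
`det(t I_n + Vᵀ B V) = t⁻¹ det(t I_{n+1} + V Vᵀ B)` for `t ≠ 0`. [folklore] -/
theorem det_smul_one_add_compression_eq (B : Matrix (Fin (n + 1)) (Fin (n + 1)) ℝ) {t : ℝ}
    (ht : t ≠ 0) :
    det (t • (1 : Matrix (Fin n) (Fin n) ℝ) + Vᵀ * B * V) =
      t⁻¹ * det (t • (1 : Matrix (Fin (n + 1)) (Fin (n + 1)) ℝ) + V * Vᵀ * B) := by
  have h1 : t • (1 : Matrix (Fin n) (Fin n) ℝ) + Vᵀ * B * V =
      t • (1 + (Vᵀ * (t⁻¹ • B)) * V) := by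
    rw [smul_add, Matrix.mul_smul, Matrix.smul_mul, smul_smul, mul_inv_cancel₀ ht, one_smul]
  have h2 : t • (1 : Matrix (Fin (n + 1)) (Fin (n + 1)) ℝ) + V * Vᵀ * B =
      t • (1 + V * (Vᵀ * (t⁻¹ • B))) := by
    rw [smul_add, Matrix.mul_smul, Matrix.mul_smul, smul_smul, mul_inv_cancel₀ ht, one_smul,
      Matrix.mul_assoc]
  rw [h1, h2, det_smul, det_smul, det_one_add_mul_comm, Fintype.card_fin, Fintype.card_fin,
    pow_succ]
  field_simp

variable (hV : V * Vᵀ = 1 - ((n : ℝ) + 1)⁻¹ • Matrix.of (fun _ _ => (1 : ℝ)))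
include hV

/-- **Saunderson–Parrilo Lemma 1, pointwise**: for `t ≠ 0` with all `t + xᵢ ≠ 0`,
`(n+1) det(t I + Vᵀ diag(x) V) = ∑ᵢ ∏_{j ≠ i} (t + xⱼ)` (`= p_x'(t) = e_n(x + t𝟙)`).
[cite: SaundersonParrilo2014, Lemma 1] -/
theorem det_compression_pointwise (x : Fin (n + 1) → ℝ) {t : ℝ} (ht : t ≠ 0)
    (htx : ∀ i, t + x i ≠ 0) :
    ((n : ℝ) + 1) * det (t • (1 : Matrix (Fin n) (Fin n) ℝ) + Vᵀ * diagonal x * V) =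
      ∑ i, ∏ j ∈ univ.erase i, (t + x j) := by
  have hN : ((n : ℝ) + 1) ≠ 0 := by positivity
  rw [det_smul_one_add_compression_eq (diagonal x) ht, hV]
  -- `t I + (I - J/(n+1)) D = diag(t + xᵢ) + (-(n+1)⁻¹ 𝟙) xᵀ`
  have hJD : Matrix.of (fun _ _ => (1 : ℝ)) * diagonal x = vecMulVec (fun _ => (1 : ℝ)) x := by
    ext i j
    simp [mul_diagonal, vecMulVec_apply]
  have hmat : t • (1 : Matrix (Fin (n + 1)) (Fin (n + 1)) ℝ) +
      (1 - ((n : ℝ) + 1)⁻¹ • Matrix.of (fun _ _ => (1 : ℝ))) * diagonal x =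
        diagonal (fun i => t + x i) + vecMulVec (fun _ => -((n : ℝ) + 1)⁻¹) x := by
    rw [Matrix.sub_mul, Matrix.one_mul, Matrix.smul_mul, hJD, smul_one_eq_diagonal, ← add_sub_assoc,
      diagonal_add]
    ext i j
    simp only [Matrix.sub_apply, Matrix.add_apply, Matrix.smul_apply, vecMulVec_apply, smul_eq_mul]
    ring
  rw [hmat, det_diagonal_add_vecMulVec _ _ _ htx]
  -- algebra: `(n+1) t⁻¹ p (1 - (n+1)⁻¹ ∑ xᵢ/(t+xᵢ)) = ∑ᵢ ∏_{j≠i} (t + xⱼ)`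
  have hq : ∀ i, (∏ j, (t + x j)) = (t + x i) * ∏ j ∈ univ.erase i, (t + x j) := fun i =>
    (Finset.mul_prod_erase _ _ (Finset.mem_univ i)).symm
  have hsum : (∏ j, (t + x j)) * ∑ i, x i * (-((n : ℝ) + 1)⁻¹ / (t + x i)) =
      -((n : ℝ) + 1)⁻¹ * ∑ i, x i * ∏ j ∈ univ.erase i, (t + x j) := by
    rw [Finset.mul_sum, Finset.mul_sum]
    refine Finset.sum_congr rfl fun i _ => ?_
    rw [hq i]
    have := htx i
    field_simp
  have hkey : ((n : ℝ) + 1) * ∏ j, (t + x j) - ∑ i, x i * ∏ j ∈ univ.erase i, (t + x j) =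
      t * ∑ i, ∏ j ∈ univ.erase i, (t + x j) := by
    have : ((n : ℝ) + 1) * ∏ j, (t + x j) = ∑ i : Fin (n + 1), ∏ j, (t + x j) := by
      rw [Finset.sum_const, Finset.card_univ, Fintype.card_fin, nsmul_eq_mul]
      push_cast
      ring
    rw [this, ← Finset.sum_sub_distrib, Finset.mul_sum]
    refine Finset.sum_congr rfl fun i _ => ?_
    rw [hq i]
    ring
  rw [mul_add, mul_one, hsum]
  field_simp
  linear_combination hkey

/-- **Saunderson–Parrilo Lemma 3, pointwise** (determinantal expression of the polar derivative):
for `s = ∑ xᵢ ≠ 0`, `t ≠ 0` and all `t + xᵢ ≠ 0`, the Schur complement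
`S = Vᵀ diag(x) V - s⁻¹ (Vᵀx)(Vᵀx)ᵀ` satisfies `s · det(t I + S) = ∑ᵢ xᵢ ∏_{j ≠ i} (t + xⱼ)`
(`= N p(t) - t p'(t) = ∂ₛ e_{n+1}(s x + t𝟙)|_{s=1}`). [cite: SaundersonParrilo2014, Lemma 3] -/
theorem det_schurCompression_pointwise (x : Fin (n + 1) → ℝ) (hs : ∑ i, x i ≠ 0) {t : ℝ}
    (ht : t ≠ 0) (htx : ∀ i, t + x i ≠ 0) :
    (∑ i, x i) * det (t • (1 : Matrix (Fin n) (Fin n) ℝ) +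
        (Vᵀ * diagonal x * V - (∑ i, x i)⁻¹ • vecMulVec (Vᵀ *ᵥ x) (Vᵀ *ᵥ x))) =
      ∑ i, x i * ∏ j ∈ univ.erase i, (t + x j) := by
  set s : ℝ := ∑ i, x i with hs_def
  -- `Vᵀ diag(x) V - s⁻¹ (Vᵀx)(Vᵀx)ᵀ = Vᵀ B₀ V` with `B₀ = diag(x) - s⁻¹ x xᵀ`
  have hB : Vᵀ * diagonal x * V - s⁻¹ • vecMulVec (Vᵀ *ᵥ x) (Vᵀ *ᵥ x) =
      Vᵀ * (diagonal x - s⁻¹ • vecMulVec x x) * V := by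
    rw [Matrix.mul_sub, Matrix.sub_mul, Matrix.mul_smul, Matrix.smul_mul]
    congr 2
    rw [vecMulVec_eq Unit, vecMulVec_eq Unit, ← Matrix.mul_assoc, ← replicateCol_mulVec,
      Matrix.mul_assoc, ← replicateRow_vecMul, ← mulVec_transpose]
  rw [hB, det_smul_one_add_compression_eq _ ht, hV]
  -- `(I - J/N)(D - s⁻¹ x xᵀ) = D - s⁻¹ x xᵀ` since `J (D - s⁻¹ x xᵀ) = 𝟙 xᵀ - s⁻¹ (𝟙ᵀ x) 𝟙 xᵀ = 0`
  have hJD : Matrix.of (fun _ _ => (1 : ℝ)) * diagonal x = vecMulVec (fun _ => (1 : ℝ)) x := by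
    ext i j
    simp [mul_diagonal, vecMulVec_apply]
  have hJxx : Matrix.of (fun _ _ => (1 : ℝ)) * vecMulVec x x = vecMulVec (fun _ => s) x := by
    ext i j
    simp only [mul_apply, of_apply, vecMulVec_apply, one_mul]
    rw [← Finset.sum_mul]
  have hJ : Matrix.of (fun _ _ => (1 : ℝ)) * (diagonal x - s⁻¹ • vecMulVec x x) =
      (0 : Matrix (Fin (n + 1)) (Fin (n + 1)) ℝ) := by
    rw [Matrix.mul_sub, Matrix.mul_smul, hJD, hJxx]
    ext i j
    simp only [Matrix.sub_apply, Matrix.smul_apply, vecMulVec_apply, smul_eq_mul, Matrix.zero_apply,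
      one_mul]
    rw [← mul_assoc, inv_mul_cancel₀ hs, one_mul, sub_self]
  have hmat : t • (1 : Matrix (Fin (n + 1)) (Fin (n + 1)) ℝ) +
      (1 - ((n : ℝ) + 1)⁻¹ • Matrix.of (fun _ _ => (1 : ℝ))) * (diagonal x - s⁻¹ • vecMulVec x x) =
        diagonal (fun i => t + x i) + vecMulVec (fun i => -s⁻¹ * x i) x := by
    rw [Matrix.sub_mul, Matrix.smul_mul, hJ, smul_zero, sub_zero, Matrix.one_mul,
      smul_one_eq_diagonal, ← add_sub_assoc, diagonal_add]
    ext i j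
    simp only [Matrix.sub_apply, Matrix.add_apply, Matrix.smul_apply, vecMulVec_apply, smul_eq_mul]
    ring
  rw [hmat, det_diagonal_add_vecMulVec _ _ _ htx]
  have hq : ∀ i, (∏ j, (t + x j)) = (t + x i) * ∏ j ∈ univ.erase i, (t + x j) := fun i =>
    (Finset.mul_prod_erase _ _ (Finset.mem_univ i)).symm
  have hsum : (∏ j, (t + x j)) * ∑ i, x i * (-s⁻¹ * x i / (t + x i)) =
      -s⁻¹ * ∑ i, x i ^ 2 * ∏ j ∈ univ.erase i, (t + x j) := by
    rw [Finset.mul_sum, Finset.mul_sum]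
    refine Finset.sum_congr rfl fun i _ => ?_
    rw [hq i]
    have := htx i
    field_simp
  have hkey : s * ∏ j, (t + x j) - ∑ i, x i ^ 2 * ∏ j ∈ univ.erase i, (t + x j) =
      t * ∑ i, x i * ∏ j ∈ univ.erase i, (t + x j) := by
    rw [hs_def, Finset.sum_mul, ← Finset.sum_sub_distrib, Finset.mul_sum]
    refine Finset.sum_congr rfl fun i _ => ?_
    rw [hq i]
    ring
  rw [mul_add, mul_one, hsum]
  field_simp
  linear_combination hkey

end Pointwise

/-! ### Coefficient identities through an orthogonal diagonalisation -/

section Coefficients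

/-- `det(t I + U diag(d) Uᵀ) = ∏ (t + dⱼ)` for `U Uᵀ = I`. [folklore] -/
theorem det_smul_one_add_conj_diagonal {m : Type*} [Fintype m] [DecidableEq m]
    {U : Matrix m m ℝ} (hU : U * Uᵀ = 1) (d : m → ℝ) (t : ℝ) :
    det (t • (1 : Matrix m m ℝ) + U * diagonal d * Uᵀ) = ∏ j, (t + d j) := by
  have h1 : U * (t • (1 : Matrix m m ℝ)) * Uᵀ = t • (1 : Matrix m m ℝ) := by
    rw [Matrix.mul_smul, Matrix.mul_one, Matrix.smul_mul, hU]
  have h2 : t • (1 : Matrix m m ℝ) + U * diagonal d * Uᵀ =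
      U * (t • (1 : Matrix m m ℝ) + diagonal d) * Uᵀ := by
    rw [Matrix.mul_add, Matrix.add_mul, h1]
  have h3 : t • (1 : Matrix m m ℝ) + diagonal d = diagonal fun j => t + d j := by
    rw [smul_one_eq_diagonal, diagonal_add]
  rw [h2, det_mul, det_mul, h3, det_diagonal, mul_comm (det U), mul_assoc, ← det_mul, hU, det_one,
    mul_one]

variable {n : ℕ} {V : Matrix (Fin (n + 1)) (Fin n) ℝ}
  (hV : V * Vᵀ = 1 - ((n : ℝ) + 1)⁻¹ • Matrix.of (fun _ _ => (1 : ℝ)))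
include hV

/-- **Coefficient form of Lemma 1** (Saunderson–Parrilo, proof of Prop. 2:
"`n E_{(n-1)-(i-1)}(V_nᵀ diag(x) V_n) = (n-i) e_{n-i}(x)`"), here in dimension `n+1` and through an
arbitrary orthogonal diagonalisation `Vᵀ diag(x) V = U diag(d) Uᵀ`:
`(n+1) e_j(d) = (n+1-j) e_j(x)` for `j ≤ n`. [cite: SaundersonParrilo2014, proof of Prop. 2] -/
theorem esymm_eigenvalues_compression (x : Fin (n + 1) → ℝ) {U : Matrix (Fin n) (Fin n) ℝ}
    (hU : U * Uᵀ = 1) {d : Fin n → ℝ} (hd : Vᵀ * diagonal x * V = U * diagonal d * Uᵀ) {j : ℕ}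
    (hj : j ≤ n) :
    ((n : ℝ) + 1) * MvPolynomial.eval d (MvPolynomial.esymm (Fin n) ℝ j) =
      ((n : ℝ) + 1 - j) * MvPolynomial.eval x (MvPolynomial.esymm (Fin (n + 1)) ℝ j) := by
  -- the polynomial identity `(n+1) ∏ (X + dⱼ) = (∏ (X + xᵢ))'`
  have hpoly : C ((n : ℝ) + 1) * ∏ j, (X + C (d j)) = derivative (∏ i, (X + C (x i))) := by
    apply Polynomial.eq_of_infinite_eval_eq
    refine (infinite_setOf_generic x).mono fun t ht => ?_
    obtain ⟨ht0, htx⟩ := ht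
    simp only [Set.mem_setOf_eq]
    rw [eval_mul, eval_C, eval_prod, derivative_prod_X_add_C_eq, eval_finsetSum]
    simp only [eval_add, eval_X, eval_C, eval_prod]
    rw [← det_smul_one_add_conj_diagonal hU d t, ← hd, det_compression_pointwise hV x ht0 htx]
  have hc : (C ((n : ℝ) + 1) * ∏ j, (X + C (d j))).coeff (n - j) =
      (derivative (∏ i, (X + C (x i)))).coeff (n - j) := by rw [hpoly]
  rw [coeff_C_mul, coeff_prod_X_add_C_eq_esymm d (Nat.sub_le n j), Nat.sub_sub_self hj,
    coeff_derivative_prod_X_add_C x (by omega), show n + 1 - (n - j + 1) = j by omega,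
    Nat.cast_sub hj] at hc
  rw [hc]
  ring

/-- **Coefficient form of Lemmas 3–4** (Saunderson–Parrilo Lemma 4:
"`e₁(x) E_{n-1-k}((M/M₂₂)(x)) = (n-k) e_{n-k}(x)`"), in dimension `n+1`, through an arbitrary
orthogonal diagonalisation of the Schur complement
`Vᵀ diag(x) V - e₁(x)⁻¹ (Vᵀx)(Vᵀx)ᵀ = U diag(d) Uᵀ` (`e₁(x) = ∑ xᵢ ≠ 0`):
`e₁(x) e_j(d) = (j+1) e_{j+1}(x)` for `j ≤ n`. [cite: SaundersonParrilo2014, Lemma 4] -/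
theorem esymm_eigenvalues_schurCompression (x : Fin (n + 1) → ℝ) (hs : ∑ i, x i ≠ 0)
    {U : Matrix (Fin n) (Fin n) ℝ} (hU : U * Uᵀ = 1) {d : Fin n → ℝ}
    (hd : Vᵀ * diagonal x * V - (∑ i, x i)⁻¹ • vecMulVec (Vᵀ *ᵥ x) (Vᵀ *ᵥ x) =
      U * diagonal d * Uᵀ) {j : ℕ} (hj : j ≤ n) :
    (∑ i, x i) * MvPolynomial.eval d (MvPolynomial.esymm (Fin n) ℝ j) =
      ((j : ℝ) + 1) * MvPolynomial.eval x (MvPolynomial.esymm (Fin (n + 1)) ℝ (j + 1)) := by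
  have hpoly : C (∑ i, x i) * ∏ j, (X + C (d j)) =
      ∑ i, C (x i) * ∏ j ∈ univ.erase i, (X + C (x j)) := by
    apply Polynomial.eq_of_infinite_eval_eq
    refine (infinite_setOf_generic x).mono fun t ht => ?_
    obtain ⟨ht0, htx⟩ := ht
    simp only [Set.mem_setOf_eq]
    rw [eval_mul, eval_C, eval_prod, eval_finsetSum]
    simp only [eval_add, eval_X, eval_C, eval_prod, eval_mul]
    rw [← det_smul_one_add_conj_diagonal hU d t, ← hd,
      det_schurCompression_pointwise hV x hs ht0 htx]
  have hc : (C (∑ i, x i) * ∏ j, (X + C (d j))).coeff (n - j) =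
      (∑ i, C (x i) * ∏ j ∈ univ.erase i, (X + C (x j))).coeff (n - j) := by rw [hpoly]
  rw [coeff_C_mul, coeff_prod_X_add_C_eq_esymm d (Nat.sub_le n j), Nat.sub_sub_self hj,
    coeff_sum_C_mul_prod_erase x (by omega), show n + 1 - (n - j) = j + 1 by omega,
    Nat.cast_sub hj] at hc
  rw [hc]
  push_cast
  ring

end Coefficients

end Literature.AlgebraicGeometry.HyperbolicPolynomials

end
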